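import Summits.HodgeConjecture.HodgeConjecture.Theorems.VHCAbelianSchemesRoadSecondCarriedHGoodTypingDefs
import HarnessLib

/-!
# Road №4 (`VHCAbelianSchemesRoad`) — the mover SCALES THE PIN: `ḡ_u^* h_Y(θ₀) = Nm(u)·h_Y(θ₀)`, `Nm(m + φ_d) = m² + d`
# (helper toward child (c3) `stub_secondCarriedOfOffDiagonalVanishingPrime_of_T_GRR` of crux stmt-HodgeConjecture-26512,
# skeleton v3.9 `Cruxes/DiagLocalOfMarkmanPinnedForall/Lines/birth.lean` f1912d6f699b48a2)

research route conditional on HC_CM; not a corollary; Q11.4-sentence-2 already refuted in dim ≥ 3.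

THEOREMS ONLY (ring2-b03x gen 14; fact-free, no definition, `HC_CM` nowhere; `--supports stmt-HodgeConjecture-26512`). The moved
datum of the (c3) signature (`IsogenyMovesPinnedTwistedData`, p618714) transports the pins `κ_k = c_k·θᵏ` along `g^*` and so needs
`g^*θ = N·θ` for the mover `g = ḡ_u`, `u = m + φ_d` (`SecantQuotientDatum.IsMover m g`: `q ≫ g = u ≫ q`) and the pin `θ = h_Y(θ₀)`.
Print: `η(k)^*h = Nm(k)·h` (van Geemen 4.9, `E(kx, ky) = Nm(k)E(x, y)`; Markman §1.3). The tree had the case `k = √−d`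
(`complexBetti_map_weilOperator_weilPolarizationClass`: `φ_d^*Ξ_d = d·Ξ_d`, R2's `SecantQuotientDatum.complexBetti_map_ψ_map_q_hY`), but
pull-back along a SUM of homomorphisms is not additive on `H²`, so `(m·𝟙 + φ_d)^*` needs the cross term:

* §1 `complexBetti_map_zsmul_add_zsmul_two` — **`(m·f + n·g)^* = m²·f^* + n²·g^* + mn·((f + g)^* − f^* − g^*)` on `H²(B(ℂ); ℂ)`**
  for homomorphisms `f, g : A ⟶ B` of complex abelian varieties and `m, n : ℤ`: `H²` is spanned by products `v₀ ⌣ v₁` of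
  degree-one classes (`AbelianVariety.hasExteriorCohomologyH1_complexPoints`), on which pull-back is multiplicative (`complexBetti_map_cupPowOne`)
  and ADDITIVE IN THE MORPHISM in degree one (`complexBetti_map_add_one`, `complexBetti_map_zsmul_one`).
* §2 `complexBetti_map_zsmul_id_add_weilOperator_weilPolarizationClass` — **`(m·𝟙 + φ_d)^*Ξ_d(θ) = (m² + d)·Ξ_d(θ)`** on `J × Ĵ`
  (`Θ` principal): with `F = p₁`, `G = p₂ ≫ φ_Θ⁻¹`, `Ξ_d(θ) = F^*θ + d·G^*θ`, `(m·𝟙 + φ_d) ≫ p₁ = m·F − d·G` and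
  `(m·𝟙 + φ_d) ≫ p₂ = (F + m·G) ≫ φ_Θ`, the two cross terms `∓md·X(F, G)θ` CANCEL (§1 twice).
* §3 at a datum: `SecantQuotientDatum.complexBetti_map_weilEndo_weilPolarizationClass` and, for a mover,
  **`SecantQuotientDatum.IsMover.complexBetti_map_hY : g^*h_Y(θ₀) = (m² + d)·h_Y(θ₀)`** (`q^*` injective, `q^*g^* = u^*q^*`).

Nothing here says any stub, (c3), 2m′ᵒᴴ, 26512, `HC_AV` or HC holds. References: [cite: vanGeemen1994HodgeAV, 4.8–4.9 and Lemma 5.2]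
[cite: Markman2025SecantWeil, §1.3 (η(k)^*h = Nm(k)h), §3.2 Cor. 3.2.3 and §1.5 (p. 7)] [cite: HatcherAT2002, §3.2 and Prop. 3.10]
[cite: LangeBirkenhake1992, §1.1 (p. 19)] [cite: MumfordAV1970, §1 (3) and §19].
-/

noncomputable section

open CategoryTheory CategoryTheory.Limits AlgebraicGeometry Topology

namespace Summit.HodgeConjecture.HodgeConjecture.Ring2.SemiregularRepresentatives

set_option linter.dupNamespace false -- the cell's namespace repeats the summit name, as in every `Ring2*` file

open Literature.AlgebraicGeometry Literature.AlgebraicGeometry.Motives Literature.AlgebraicGeometry.Motives.AbelianVariety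
open Literature.AlgebraicGeometry.HodgeTheory Literature.AlgebraicGeometry.Markman2025
open Literature.AlgebraicTopology.SingularHomology

/-! ## §1 The cross-term formula for pull-back along `m·f + n·g` on `H²` -/

section CrossTerm

variable {A B : AbelianVariety ℂ}

/-- **`(m·f + n·g)^* = m·f^* + n·g^*` on `H¹(B(ℂ); ℂ)`**, element form, `m n : ℤ` (additivity of `H¹` in the morphism).
[cite: LangeBirkenhake1992, §1.1 (p. 19)] -/
theorem complexBetti_map_zsmul_add_zsmul_one (f g : A ⟶ B) (m n : ℤ) (c : complexBetti B.X 1) :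
    complexBetti.map (m • f + n • g).hom.hom.hom 1 c =
      (m : ℂ) • complexBetti.map f.hom.hom.hom 1 c + (n : ℂ) • complexBetti.map g.hom.hom.hom 1 c := by
  rw [complexBetti_map_add_one, complexBetti_map_zsmul_one, complexBetti_map_zsmul_one]
  change ((m • complexBetti.map f.hom.hom.hom 1 + n • complexBetti.map g.hom.hom.hom 1).hom) c = _
  rw [ModuleCat.hom_add, ModuleCat.hom_zsmul, ModuleCat.hom_zsmul, LinearMap.add_apply,
    LinearMap.smul_apply, LinearMap.smul_apply, Int.cast_smul_eq_zsmul, Int.cast_smul_eq_zsmul]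

/-- **`(f + g)^* = f^* + g^*` on `H¹(B(ℂ); ℂ)`**, element form. [cite: LangeBirkenhake1992, §1.1 (p. 19)] -/
theorem complexBetti_map_add_one_apply (f g : A ⟶ B) (c : complexBetti B.X 1) :
    complexBetti.map (f + g).hom.hom.hom 1 c = complexBetti.map f.hom.hom.hom 1 c + complexBetti.map g.hom.hom.hom 1 c := by
  rw [complexBetti_map_add_one]
  rfl

/-- The iterated product of two degree-one classes is their cup product: `m₂(v) = v₀ ⌣ v₁`. [cite: HatcherAT2002, §3.2] -/
theorem cupPowOne_two (v : Fin 2 → complexBetti B.X 1) :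
    cupPowOne ℂ (ComplexPoints B.X) 2 v = cupProduct (Nat.add_comm 1 1) (v 0) (v 1) := by
  rw [cupPowOne_succ, cupPowOne_one]
  rfl

/-- **THE CROSS-TERM FORMULA**: for homomorphisms `f, g : A ⟶ B` of complex abelian varieties, `m, n : ℤ` and `θ ∈ H²(B(ℂ); ℂ)`,
`(m·f + n·g)^*θ = m²·f^*θ + n²·g^*θ + mn·((f + g)^*θ − f^*θ − g^*θ)` — on a product `v₀ ⌣ v₁` of degree-one classes both sides are
`m²·f^*v₀ ⌣ f^*v₁ + n²·g^*v₀ ⌣ g^*v₁ + mn·(f^*v₀ ⌣ g^*v₁ + g^*v₀ ⌣ f^*v₁)`, and `H²` is spanned by such products.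
[cite: MumfordAV1970, §1 (3) and §19] [cite: HatcherAT2002, Prop. 3.10] [cite: LangeBirkenhake1992, §1.1 (p. 19)] -/
theorem complexBetti_map_zsmul_add_zsmul_two (f g : A ⟶ B) (m n : ℤ) (θ : complexBetti B.X 2) :
    complexBetti.map (m • f + n • g).hom.hom.hom 2 θ =
      ((m : ℂ) ^ 2) • complexBetti.map f.hom.hom.hom 2 θ + ((n : ℂ) ^ 2) • complexBetti.map g.hom.hom.hom 2 θ +
        ((m : ℂ) * n) • (complexBetti.map (f + g).hom.hom.hom 2 θ - complexBetti.map f.hom.hom.hom 2 θ -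
          complexBetti.map g.hom.hom.hom 2 θ) := by
  have hspan := (AbelianVariety.hasExteriorCohomologyH1_complexPoints B).span_range_cupPowOne 2
  have hθ : θ ∈ Submodule.span ℂ (Set.range (cupPowOne ℂ (ComplexPoints B.X) 2)) := by
    rw [hspan]; exact Submodule.mem_top
  induction hθ using Submodule.span_induction with
  | mem x hx =>
    obtain ⟨v, rfl⟩ := hx
    have e1 : complexBetti.map (m • f + n • g).hom.hom.hom 2 (cupPowOne ℂ (ComplexPoints B.X) 2 v) =
        cupPowOne ℂ (ComplexPoints A.X) 2 fun i => complexBetti.map (m • f + n • g).hom.hom.hom 1 (v i) :=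
      complexBetti_map_cupPowOne _ 2 v
    have e2 : complexBetti.map (f + g).hom.hom.hom 2 (cupPowOne ℂ (ComplexPoints B.X) 2 v) =
        cupPowOne ℂ (ComplexPoints A.X) 2 fun i => complexBetti.map (f + g).hom.hom.hom 1 (v i) :=
      complexBetti_map_cupPowOne _ 2 v
    have e3 : complexBetti.map f.hom.hom.hom 2 (cupPowOne ℂ (ComplexPoints B.X) 2 v) =
        cupPowOne ℂ (ComplexPoints A.X) 2 fun i => complexBetti.map f.hom.hom.hom 1 (v i) :=
      complexBetti_map_cupPowOne _ 2 v
    have e4 : complexBetti.map g.hom.hom.hom 2 (cupPowOne ℂ (ComplexPoints B.X) 2 v) =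
        cupPowOne ℂ (ComplexPoints A.X) 2 fun i => complexBetti.map g.hom.hom.hom 1 (v i) :=
      complexBetti_map_cupPowOne _ 2 v
    rw [e1, e2, e3, e4, cupPowOne_two, cupPowOne_two, cupPowOne_two, cupPowOne_two]
    dsimp only
    rw [complexBetti_map_zsmul_add_zsmul_one, complexBetti_map_zsmul_add_zsmul_one, complexBetti_map_add_one_apply,
      complexBetti_map_add_one_apply]
    simp only [map_add, map_smul, LinearMap.add_apply, LinearMap.smul_apply]
    module
  | zero => simp only [map_zero, smul_zero, sub_zero, add_zero]
  | add x y _ _ hx hy =>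
    simp only [map_add, hx, hy]
    module
  | smul r x _ hx =>
    simp only [map_smul, hx]
    module

end CrossTerm

/-! ## §2 `(m·𝟙 + φ_d)^*Ξ_d = (m² + d)·Ξ_d` on `J × Ĵ` -/

section WeilPolarization

variable (J : AbelianVariety ℂ) {Θ : CartierDivisor J.X.left} (hΘ : Θ.IsAmple)

/-- **`(m·𝟙 + φ_d)^*Ξ_d(θ) = (m² + d)·Ξ_d(θ)`**: the element `u = m + φ_d ∈ ℤ[φ_d]` pulls Markman's Weil polarisation class
`Ξ_d(θ) = p₁^*θ + d·p₂^*θ̂` back to `Nm(u)·Ξ_d(θ)`, `Nm(u) = m² + d` (van Geemen's compatibility `E(kx, ky) = Nm(k)E(x, y)` for every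
`k ∈ K`, not only `k = √−d`). Proof: `F = p₁`, `G = p₂ ≫ φ_Θ⁻¹`, `u ≫ p₁ = m·F − d·G`, `u ≫ p₂ = (F + m·G) ≫ φ_Θ`, §1 twice; the cross
terms cancel. [cite: vanGeemen1994HodgeAV, 4.9 and Lemma 5.2] [cite: Markman2025SecantWeil, §1.3 and §3.2 Cor. 3.2.3] -/
theorem complexBetti_map_zsmul_id_add_weilOperator_weilPolarizationClass (hK : J.KTheta Θ = ⊥) (d : ℕ) (m : ℤ)
    (θ : complexBetti J.X 2) :
    complexBetti.map (m • 𝟙 (J.prod (J.dualOf Θ hΘ)) + weilOperator hΘ hK d).hom.hom.hom 2 (weilPolarizationClass J hΘ d θ) =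
      ((m : ℂ) ^ 2 + d) • weilPolarizationClass J hΘ d θ := by
  haveI := J.isIso_phiTheta_of_KTheta_eq_bot hΘ hK
  set P := J.prod (J.dualOf Θ hΘ) with hP
  set F : P ⟶ J := fst J (J.dualOf Θ hΘ) with hF
  set G : P ⟶ J := snd J (J.dualOf Θ hΘ) ≫ inv (J.phiTheta Θ hΘ) with hG
  set u : P ⟶ P := m • 𝟙 P + weilOperator hΘ hK d with hu
  -- `p₂^*θ̂ = G^*θ`
  have hGθ : complexBetti.map (snd J (J.dualOf Θ hΘ)).hom.hom.hom 2 (J.dualClassOf hΘ θ) = complexBetti.map G.hom.hom.hom 2 θ := by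
    rw [J.dualClassOf_eq_map_inv hΘ hK θ, ← complexBetti_map_comp_hom_apply]
  -- the two components of `u`
  have hu₁ : u ≫ fst J (J.dualOf Θ hΘ) = m • F + (-(d : ℤ)) • G := by
    rw [hu, Preadditive.add_comp, Preadditive.zsmul_comp, Category.id_comp, weilOperator_fst, neg_smul]
  have hu₂ : u ≫ snd J (J.dualOf Θ hΘ) = ((1 : ℤ) • F + m • G) ≫ J.phiTheta Θ hΘ := by
    rw [hu, Preadditive.add_comp, Preadditive.zsmul_comp, Category.id_comp, weilOperator_snd, one_smul, Preadditive.add_comp,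
      Preadditive.zsmul_comp, hG, Category.assoc, IsIso.inv_hom_id, Category.comp_id, add_comm]
  have h1 : complexBetti.map u.hom.hom.hom 2 (complexBetti.map (fst J (J.dualOf Θ hΘ)).hom.hom.hom 2 θ) =
      ((m : ℂ) ^ 2) • complexBetti.map F.hom.hom.hom 2 θ + (((-(d : ℤ) : ℤ) : ℂ) ^ 2) • complexBetti.map G.hom.hom.hom 2 θ +
        ((m : ℂ) * ((-(d : ℤ) : ℤ) : ℂ)) • (complexBetti.map (F + G).hom.hom.hom 2 θ - complexBetti.map F.hom.hom.hom 2 θ -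
          complexBetti.map G.hom.hom.hom 2 θ) := by
    rw [← complexBetti_map_comp_hom_apply, hu₁, complexBetti_map_zsmul_add_zsmul_two]
  have h2 : complexBetti.map u.hom.hom.hom 2 (complexBetti.map (snd J (J.dualOf Θ hΘ)).hom.hom.hom 2 (J.dualClassOf hΘ θ)) =
      (((1 : ℤ) : ℂ) ^ 2) • complexBetti.map F.hom.hom.hom 2 θ + ((m : ℂ) ^ 2) • complexBetti.map G.hom.hom.hom 2 θ +
        ((((1 : ℤ) : ℂ)) * (m : ℂ)) • (complexBetti.map (F + G).hom.hom.hom 2 θ - complexBetti.map F.hom.hom.hom 2 θ -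
          complexBetti.map G.hom.hom.hom 2 θ) := by
    rw [← complexBetti_map_comp_hom_apply, hu₂, complexBetti_map_comp_hom_apply, J.complexBetti_map_phiTheta_dualClassOf hΘ θ,
      complexBetti_map_zsmul_add_zsmul_two]
  rw [weilPolarizationClass, map_add, map_smul, h1, h2, hGθ]
  push_cast
  module

end WeilPolarization

/-! ## §3 At a secant–quotient datum: the mover scales the descended pin -/

namespace SecantQuotientDatum

variable (D : SecantQuotientDatum)

/-- **`u^*Ξ_d(θ₀) = (m² + d)·Ξ_d(θ₀)`** for the datum's `u = m + φ_d` (`D.weilEndo m`).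
[cite: vanGeemen1994HodgeAV, 4.9] [cite: Markman2025SecantWeil, §1.3 and §3.2 Cor. 3.2.3] -/
theorem complexBetti_map_weilEndo_weilPolarizationClass (m : ℤ) (θ₀ : complexBetti D.𝒥.J.X 2) :
    complexBetti.map (D.weilEndo m).hom.hom.hom 2 (weilPolarizationClass D.𝒥.J D.isAmple D.d θ₀) =
      ((m : ℂ) ^ 2 + D.d) • weilPolarizationClass D.𝒥.J D.isAmple D.d θ₀ := by
  rw [weilEndo_def]
  exact complexBetti_map_zsmul_id_add_weilOperator_weilPolarizationClass D.𝒥.J D.isAmple D.KTheta_eq_bot D.d m θ₀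

/-- **`u^*(q^*h_Y(θ₀)) = (m² + d)·q^*h_Y(θ₀)`** (`q^*h_Y(θ₀) = Ξ_d(θ₀)`, R2). [cite: Markman2025SecantWeil, §1.3 and §1.5 (p. 7)] -/
theorem complexBetti_map_weilEndo_map_q_hY (m : ℤ) (θ₀ : complexBetti D.𝒥.J.X 2) :
    complexBetti.map (D.weilEndo m).hom.hom.hom 2 (complexBetti.map D.q.hom.hom.hom 2 (D.hY θ₀)) =
      ((m : ℂ) ^ 2 + D.d) • complexBetti.map D.q.hom.hom.hom 2 (D.hY θ₀) := by
  rw [D.complexBetti_map_q_hY, weilEndo_def]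
  exact complexBetti_map_zsmul_id_add_weilOperator_weilPolarizationClass D.𝒥.J D.isAmple D.KTheta_eq_bot D.d m θ₀

variable {D}

/-- **THE MOVER SCALES THE PIN: `ḡ_u^* h_Y(θ₀) = (m² + d)·h_Y(θ₀)`** for a mover `g` of `u = m + φ_d` (`D.IsMover m g`:
`q ≫ g = u ≫ q`): `q^*(g^*h_Y) = u^*(q^*h_Y) = (m² + d)·q^*h_Y` and `q^*` is injective. This is the scalar `N = Nm(u)` of the moved
datum `IsogenyMovesPinnedTwistedData` at `θ = h_Y(θ₀)`. [cite: vanGeemen1994HodgeAV, 4.9 (E(kx, ky) = Nm(k)E(x, y))]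
[cite: Markman2025SecantWeil, §1.3 (η(k)^*h = Nm(k)h) and §1.5 (p. 7)] -/
theorem IsMover.complexBetti_map_hY {m : ℤ} {g : D.Y ⟶ D.Y} (h : D.IsMover m g) (θ₀ : complexBetti D.𝒥.J.X 2) :
    complexBetti.map g.hom.hom.hom 2 (D.hY θ₀) = ((m : ℂ) ^ 2 + D.d) • D.hY θ₀ := by
  apply (D.complexBetti_map_q_bijective 2).1
  rw [← complexBetti_map_comp_hom_apply, h.q_comp, complexBetti_map_comp_hom_apply, D.complexBetti_map_weilEndo_map_q_hY, map_smul]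

/-- The scalar `m² + d` is non-zero (`d ≥ 4`). [cite: Markman2025SecantWeil, §1.5 (p. 7)] -/
theorem normWeilEndo_ne_zero (D : SecantQuotientDatum) (m : ℤ) : ((m : ℂ) ^ 2 + D.d) ≠ 0 := by
  have hd : (0 : ℝ) < D.d := by exact_mod_cast lt_of_lt_of_le (by norm_num) D.four_le
  have h : (0 : ℝ) < (m : ℝ) ^ 2 + D.d := by positivity
  intro h0
  have h1 : (((m : ℝ) ^ 2 + D.d : ℝ) : ℂ) = 0 := by push_cast; exact h0
  exact h.ne' (by exact_mod_cast h1)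

end SecantQuotientDatum

end Summit.HodgeConjecture.HodgeConjecture.Ring2.SemiregularRepresentatives

end
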